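import Summits.AtomisticToContinuum.HydrodynamicLimit.Theses.TwoClocks
import Summits.AtomisticToContinuum.HydrodynamicLimit.Theorems.TwoClocksTransferActivityTailsTransferLeHitWeight
import HarnessLib

/-!
# `TransferActivityTails` (stmt-AtomisticToContinuum-16624), line `IdeatorOneSketch`: the crux from mean-square local
equilibrium of its own window transfer activity (the averaged `L²` docking statement)

Helper file (`--supports stmt-AtomisticToContinuum-16624`) for the crux
`Summit.AtomisticToContinuum.HydrodynamicLimit.Theses.TwoClocks.TransferActivityTails` (route TwoClocks, rank 7): the a-priori
`L¹` tail bound `E_λ[(N+1)⁻¹ Σ_i a_i 𝟙{a_i > V}] ≤ ε` for the window transfer activity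
`a_i(s) = (σ/τ) Σ_{collisions of i in (s, s+w]} (‖v_i⁺ − v_i⁻‖ + |‖v_i⁺‖² − ‖v_i⁻‖²|/2)`, `w = τ (N+1)^{-1/3}`, under the true
evolution from local Gibbs data (line IdeatorOneSketch, skeleton `Cruxes/TransferActivityTails/Lines/IdeatorOneSketch.lean` v3).

This file records the docking statement CLOSEST to the crux — no energy marks, no per-sphere strengthening, no rates — and the
elementary implication:

* `TransferActivityMeanSquare`: in the crux's frame there is a level `A > 0` (after `t`, before `τ`) such that for every `δ > 0`,
  for `τ ≥ τ₀(δ)`, `N ≥ N₀(τ)` and `s ∈ [0,t]` SOME family of predictors `m_i ≤ A` (functions of the datum; e.g. the capped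
  hydrodynamic transfer-activity level at sphere `i`'s current macroscopic position — a constant at global equilibrium) has
  `E_λ[(N+1)⁻¹ Σ_i (a_i(s) − m_i)²] ≤ δ`: MEAN-SQUARE LOCAL EQUILIBRIUM of the window transfer activity (local equilibrium of the
  true pre-shock law + mean-ergodicity of a tagged sphere's collision process over `τσ² → ∞` mean free times).
* `tailFn_le_mul_sq`: the pointwise Chebyshev-type inequality `y 𝟙{y > V} ≤ (A + 1)(y − m)²` for `m ≤ A`, `A + 1 ≤ V`.
* `transferActivityTails_of_meanSquare : TransferActivityMeanSquare → TransferActivityTails` (`V₀ := A + 1`, `δ := ε/(A+1)`;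
  average the pointwise inequality over `i` and integrate — `lintegral_ofReal_le_of_le_mul`, no measurability needed).

`TransferActivityMeanSquare` is OPEN (it is the crux's dynamical content in `L²` currency; no N-uniform control of tagged-sphere
collision statistics at fixed packing is in print, at or off equilibrium — Spohn 1991 Part I §2.4); it is a route-internal
statement of the line, NOT a cited fact.  The per-sphere weighted-count versions (`TransferActivityTailsReduction.WeightedCount…`,
`TransferActivityTailsSecondMomentRung`) dominate it through the landed kinematics `a_i ≤ (σ/τ) W_i`.

References: H. Spohn, *Large Scale Dynamics of Interacting Particles* (1991), Part I §2.3–2.4, Ch. 3 (local equilibrium; the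
missing tagged-particle / ergodic input); S. Olla, S. R. S. Varadhan, H.-T. Yau, Comm. Math. Phys. 155 (1993) §1.
-/

noncomputable section

open MeasureTheory Set Filter Topology
open scoped ENNReal BigOperators

namespace Summit.AtomisticToContinuum.HydrodynamicLimit.Theorems.TransferActivityTailsMeanSquare

open Literature.MathematicalPhysics.KineticTheory Literature.Analysis.FluidPDE
open Summit.AtomisticToContinuum.HydrodynamicLimit.Theorems.CollisionActivityTailsEndpointTails
  (Flow Cfg window tailFn tailFn_of_lt tailFn_of_le lintegral_ofReal_le_of_le_mul)
open Summit.AtomisticToContinuum.HydrodynamicLimit.Theorems.TransferActivityTailsTransferLeHitWeight (transferWeight)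

/-! ## §1 Vocabulary and the docking statement -/

/-- The crux's window transfer activity `a_i(s) = (σ/τ) Σ_{collisions of i in (s, s + w]} transferWeight`, `w = τ (N+1)^{-1/3}`
(verbatim the crux's `let act`; route-internal vocabulary of line IdeatorOneSketch, crux TransferActivityTails
(stmt-AtomisticToContinuum-16624), not a cited fact). -/
def act {σ : ℝ} {N : ℕ} (Φ : Flow σ N) (τ s : ℝ) (i : Fin (N + 1)) (z : Cfg N) : ℝ :=
  σ / τ * Φ.collisionSum (Set.Ioc s (s + window τ N)) (transferWeight i) z

/-- **Mean-square local equilibrium of the window transfer activity** (route-internal docking statement of line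
IdeatorOneSketch for crux TransferActivityTails (stmt-AtomisticToContinuum-16624); NOT a cited fact, not claimed, OPEN).  In the
crux's frame (continuous positive profiles, `σ < σ₀`, classical hs-Euler solution on `[0, T)` tied to the data by the `t = 0` LLN,
every flow family, `t < T`): there is a level `A > 0` such that for every `δ > 0` there is `τ₀ > 0` with: for all `τ ≥ τ₀` there is
`N₀` such that for `N ≥ N₀` and `s ∈ [0, t]` SOME predictors `m_i ≤ A` (functions of the initial datum) satisfy
`∫ (N+1)⁻¹ Σ_i (a_i(s) − m_i)² dλ ≤ δ`. -/
def TransferActivityMeanSquare : Prop :=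
  ∀ (a₀ θ₀ : T3 → ℝ) (u₀ : T3 → V3), Continuous a₀ → Continuous θ₀ → Continuous u₀ →
    (∀ x, 0 < a₀ x) → (∀ x, 0 < θ₀ x) → ∃ σ₀ : ℝ, 0 < σ₀ ∧ ∀ σ : ℝ, 0 < σ → σ < σ₀ →
    ∀ (T : ℝ) (ρ θ : ℝ → T3 → ℝ) (u : ℝ → T3 → V3), IsHardSphereEulerSolution σ T ρ u θ →
    ∀ Φ : (N : ℕ) → Flow σ N,
    TendstoHydroFieldsAt (fun N => localGibbsLaw σ a₀ u₀ θ₀ N (Φ N)) Φ ρ u θ 0 →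
    ∀ t ∈ Set.Ico 0 T, ∃ A : ℝ, 0 < A ∧ ∀ δ : ℝ, 0 < δ → ∃ τ₀ : ℝ, 0 < τ₀ ∧ ∀ τ : ℝ, τ₀ ≤ τ →
    ∃ N₀ : ℕ, ∀ N : ℕ, N₀ ≤ N → ∀ s ∈ Set.Icc 0 t,
    ∃ m : Fin (N + 1) → Cfg N → ℝ, (∀ i z, m i z ≤ A) ∧
      ∫⁻ z, ENNReal.ofReal (((N : ℝ) + 1)⁻¹ * ∑ i : Fin (N + 1), (act (Φ N) τ s i z - m i z) ^ 2)
        ∂(localGibbsLaw σ a₀ u₀ θ₀ N (Φ N)) ≤ ENNReal.ofReal δ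

/-! ## §2 The pointwise Chebyshev-type inequality -/

/-- **`y 𝟙{y > V} ≤ (A + 1)(y − m)²`** for `m ≤ A` and `A + 1 ≤ V` (any real `y`): on `{y > V}` the deviation `d = y − m` is at
least `1`, so `y = m + d ≤ A d + d = (A + 1) d ≤ (A + 1) d²`; off it the left side vanishes. -/
theorem tailFn_le_mul_sq {A V y m : ℝ} (hA : 0 ≤ A) (hm : m ≤ A) (hV : A + 1 ≤ V) :
    tailFn V y ≤ (A + 1) * (y - m) ^ 2 := by
  by_cases hyV : V < y
  · rw [tailFn_of_lt hyV]
    have hd : 1 ≤ y - m := by linarith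
    have h1 : y ≤ (A + 1) * (y - m) := by nlinarith
    have h2 : (A + 1) * (y - m) ≤ (A + 1) * (y - m) ^ 2 := by
      apply mul_le_mul_of_nonneg_left _ (by linarith)
      nlinarith
    exact h1.trans h2
  · rw [tailFn_of_le (not_lt.1 hyV)]
    positivity

/-- Averaged form: `(N+1)⁻¹ Σ_i y_i 𝟙{y_i > V} ≤ (A + 1) · (N+1)⁻¹ Σ_i (y_i − m_i)²` for predictors `m_i ≤ A`, `A + 1 ≤ V`. -/
theorem avg_tailFn_le_mul_avg_sq {N : ℕ} {A V : ℝ} (hA : 0 ≤ A) (hV : A + 1 ≤ V) (y m : Fin (N + 1) → ℝ)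
    (hm : ∀ i, m i ≤ A) :
    ((N : ℝ) + 1)⁻¹ * ∑ i, tailFn V (y i) ≤ (A + 1) * (((N : ℝ) + 1)⁻¹ * ∑ i, (y i - m i) ^ 2) := by
  have hN : (0 : ℝ) ≤ ((N : ℝ) + 1)⁻¹ := by positivity
  calc ((N : ℝ) + 1)⁻¹ * ∑ i, tailFn V (y i)
      ≤ ((N : ℝ) + 1)⁻¹ * ∑ i, (A + 1) * (y i - m i) ^ 2 :=
        mul_le_mul_of_nonneg_left (Finset.sum_le_sum fun i _ => tailFn_le_mul_sq hA (hm i) hV) hN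
    _ = (A + 1) * (((N : ℝ) + 1)⁻¹ * ∑ i, (y i - m i) ^ 2) := by
        rw [← Finset.mul_sum]
        ring

/-! ## §3 The crux from mean-square local equilibrium -/

/-- **The crux from mean-square local equilibrium of the window transfer activity.**  Same `σ₀`; `V₀ := A + 1`; for
`V ≥ V₀` and `ε > 0` take `δ := ε / (A + 1)` and the statement's `τ₀(δ)`, `N₀(τ)`; for `N ≥ N₀`, `s ∈ [0,t]`, with the
predictors `m_i ≤ A`: pointwise `(N+1)⁻¹ Σ_i a_i 𝟙{a_i > V} ≤ (A+1) (N+1)⁻¹ Σ_i (a_i − m_i)²` (`avg_tailFn_le_mul_avg_sq`), hence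
`E[(N+1)⁻¹ Σ_i a_i 𝟙{a_i > V}] ≤ (A+1) δ = ε` (`lintegral_ofReal_le_of_le_mul`). -/
theorem transferActivityTails_of_meanSquare (h : TransferActivityMeanSquare) :
    Summit.AtomisticToContinuum.HydrodynamicLimit.Theses.TwoClocks.TransferActivityTails := by
  intro a₀ θ₀ u₀ ha hθ hu ha0 hθ0
  obtain ⟨σ₀, hσ₀, H⟩ := h a₀ θ₀ u₀ ha hθ hu ha0 hθ0
  refine ⟨σ₀, hσ₀, ?_⟩
  intro σ hσ hσlt T ρ θ u hE Φ hlim t ht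
  obtain ⟨A, hA, HA⟩ := H σ hσ hσlt T ρ θ u hE Φ hlim t ht
  refine ⟨A + 1, by linarith, ?_⟩
  intro V hV ε hε
  have hA1 : 0 < A + 1 := by linarith
  obtain ⟨τ₀, hτ₀, Hτ⟩ := HA (ε / (A + 1)) (div_pos hε hA1)
  refine ⟨τ₀, hτ₀, ?_⟩
  intro τ hτ
  obtain ⟨N₀, HN⟩ := Hτ τ hτ
  refine ⟨N₀, ?_⟩
  intro N hN s hs
  obtain ⟨m, hmA, hL⟩ := HN N hN s hs
  dsimp only
  have hptw : ∀ z, ((N : ℝ) + 1)⁻¹ * ∑ i : Fin (N + 1), tailFn V (act (Φ N) τ s i z) ≤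
      (A + 1) * (((N : ℝ) + 1)⁻¹ * ∑ i : Fin (N + 1), (act (Φ N) τ s i z - m i z) ^ 2) := fun z =>
    avg_tailFn_le_mul_avg_sq hA.le hV (fun i => act (Φ N) τ s i z) (fun i => m i z) fun i => hmA i z
  have hεeq : (A + 1) * (ε / (A + 1)) = ε := mul_div_cancel₀ _ hA1.ne'
  calc ∫⁻ z, ENNReal.ofReal (((N : ℝ) + 1)⁻¹ * ∑ i : Fin (N + 1), tailFn V (act (Φ N) τ s i z))
          ∂(localGibbsLaw σ a₀ u₀ θ₀ N (Φ N))
      ≤ ENNReal.ofReal ((A + 1) * (ε / (A + 1))) :=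
        lintegral_ofReal_le_of_le_mul hA1.le (Eventually.of_forall hptw) hL
    _ = ENNReal.ofReal ε := by rw [hεeq]

/-! ## §4 The registered reduction stub -/

/-- **The crux from mean-square local equilibrium of its window transfer activity** (registered stub
`stub_transferActivityTails_of_meanSquare` of line IdeatorOneSketch, crux TransferActivityTails (stmt-AtomisticToContinuum-16624);
sorry-free; conditional only on the displayed antecedent, the line's averaged `L²` docking statement). -/
theorem stub_transferActivityTails_of_meanSquare : TransferActivityMeanSquare → Summit.AtomisticToContinuum.HydrodynamicLimit.Theses.TwoClocks.TransferActivityTails :=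
  fun h => transferActivityTails_of_meanSquare h

end Summit.AtomisticToContinuum.HydrodynamicLimit.Theorems.TransferActivityTailsMeanSquare

end
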